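import Summits.ResolutionOfSingularities.ResolutionOfSingularities.Theorems.HomologicalConductorNoZenoFrozenDivisor
import Summits.ResolutionOfSingularities.ResolutionOfSingularities.Theorems.HomologicalConductorNoZenoTraceSocleTerminator
import HarnessLib

/-!
# Crux `NoZenoR` (stmt-ResolutionOfSingularities-19943), slot 3 `stub_noCaZenoChainSharpF`, habitat `E3^{E}`:
# SHADOW CAPTURE — `E3^{E}` ⟺ «the residues of the late conductors lie in ONE noetherian subring of the residual valuation ring»

OURS (cell res-hironaka, crux chain W4.4; lead res-L0-w44-lead-1 g10, OBJECT 3-W, the composite twin one dimension DOWN of the slot-2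
cut `Cap ⟺ noetherian capture` (`Beta1Capture` p584133 / THM NC)).  AI-written, weaker than expert review; nothing here is a statement of the
manuscript under review (Hironaka 2017).  SUPPORT-level, counted 0.  Def-free, fact-free.

For a composite datum `O ≤ O₁` the `ca`-ZENO CHAINS of `O₁`-units are read in the residue field `κ(O₁)` by the residual valuation ring
`Ō = residueValuationSubring O O₁` (`FrozenDivisor.mul_inv_mem_iff_residue`).  Hence:

* `noChain_of_shadowCapture` — if the residues of `ca(T_M)`, `M ≥ m₀`, lie in a NOETHERIAN subring `N̄ ⊆ Ō` of `κ(O₁)`, there is no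
  `ca`-Zeno chain of `O₁`-units from stage `m₀` on (the ascending-chain argument `exists_valueRise_of_noetherian`, run in `κ(O₁)`).
* `terminates_of_noChain` — conversely-directed tool: under StrictDrop, a unit stage and NO chain force a regular stage
  (`Coarsening.relativeACC_tower`); and a regular stage gives shadow capture with `N̄` = the image of the (stationary) stage
  (`shadowCapture_of_isRegularLocalRing_tower`).
* TEXT LEVEL: `e3E_of_shadowCapture3 : <ShadowCapture3> → <E3^{E}>` and `shadowCapture3_of_e3E : <E3^{E}> → <ShadowCapture3>` — `ShadowCapture3`
  := E3^{E}'s binders ⊢ «for some proper coarsening `O₁ ≠ K`, some noetherian `N̄ ⊆ Ō` holds the residues of all late conductors».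
  OUTCOME: **E3^{E} ⟺ ShadowCapture3** (kernel, both directions): the slot-3 residual is a SURFACE statement — «along the frozen prime divisor
  `E` of a threefold tower, the shadows in `κ(E)` of the cohomology annihilators are eventually captured by one noetherian subring of the
  non-discrete zero-dimensional valuation ring `Ō` of the surface field `κ(E)`».

References: OURS (idea-1 THM NC `NoetherianCapture.terminates_of_noetherianCapture`, card 8 `coarsening-thread` `Coarsening.relativeACC_tower`);
J. Novacoski, M. Spivakovsky (2014) §2.1 (`residueValuationSubring`).
-/

noncomputable section

-- single-problem summit: the doubled namespace component `ResolutionOfSingularities` is forced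
set_option linter.dupNamespace false

namespace Summit.ResolutionOfSingularities.ResolutionOfSingularities.Theorems.NoZeno.CompositeSplit

open Summit.ResolutionOfSingularities.ResolutionOfSingularities.Theses.HomologicalConductor
open Summit.ResolutionOfSingularities.ResolutionOfSingularities.Theorems.NoZeno.Birth
open Summit.ResolutionOfSingularities.ResolutionOfSingularities.Theorems.NoZeno.SandwichCluster.Parasite
open Summit.ResolutionOfSingularities.ResolutionOfSingularities.Theorems
open Summit.ResolutionOfSingularities.ResolutionOfSingularities.Theorems.NoZeno
open Literature.AlgebraicGeometry.Resolution
open IsLocalRing Polynomial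

variable {k K : Type} [Field k] [Field K] [Algebra k K]

/-! ## Shadow capture kills chains -/

/-- **SHADOW CAPTURE ⇒ NO `ca`-ZENO CHAIN.**  `O ≤ O₁`, stages inside `O`; if a noetherian subring `N̄ ⊆ Ō = residueValuationSubring O O₁` of
`κ(O₁)` contains the residues of every element of `ca(T_M)` for `M ≥ m₀`, then no sequence `z n ∈ ca(T_(m n))` (`m n ≥ m₀`) of `O₁`-units has
strictly decreasing `O`-values: the residues would be non-zero elements of `N̄` with strictly decreasing `Ō`-values
(`mul_inv_mem_iff_residue`), against `exists_valueRise_of_noetherian` in `κ(O₁)`. [this work] -/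
theorem noChain_of_shadowCapture (O O₁ : ValuationSubring K) (hO : O ≤ O₁) (A : Subalgebra k K)
    (hTO : ∀ m : ℕ, ∀ s ∈ tower O A m, s ∈ O)
    (Nb : Subring (ResidueField ↥O₁)) (hN : IsNoetherianRing ↥Nb)
    (hNO : Nb ≤ (residueValuationSubring O O₁ hO).toSubring) (m₀ : ℕ)
    (hcap : ∀ M : ℕ, m₀ ≤ M → ∀ a ∈ ca (tower O A M), ∃ h : a ∈ O₁, residue ↥O₁ ⟨a, h⟩ ∈ Nb) :
    ¬ ∃ z : ℕ → K, (∀ n : ℕ, (∃ m : ℕ, m₀ ≤ m ∧ z n ∈ ca (tower O A m)) ∧ z n ≠ 0 ∧ (z n)⁻¹ ∈ O₁) ∧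
      (∀ n : ℕ, z n * (z (n + 1))⁻¹ ∈ O) ∧ ∀ n : ℕ, z (n + 1) * (z n)⁻¹ ∉ O := by
  rintro ⟨z, hz, hdiv, hsep⟩
  have hzO : ∀ n, z n ∈ O := fun n => by
    obtain ⟨⟨m, -, hzm⟩, -, -⟩ := hz n
    exact hTO m _ (ca_subset _ hzm)
  have hzO₁ : ∀ n, z n ∈ O₁ := fun n => hO (hzO n)
  let r : ℕ → ResidueField ↥O₁ := fun n => residue ↥O₁ ⟨z n, hzO₁ n⟩
  have hrN : ∀ n, r n ∈ Nb := fun n => by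
    obtain ⟨⟨m, hm, hzm⟩, -, -⟩ := hz n
    obtain ⟨h, hmem⟩ := hcap m hm (z n) hzm
    exact hmem
  have hr0 : ∀ n, r n ≠ 0 := fun n => TraceSocle.residue_ne_zero_of_inv_mem O₁ (hzO₁ n) (hz n).2.2 (hz n).2.1
  have hrdiv : ∀ n, r n * (r (n + 1))⁻¹ ∈ residueValuationSubring O O₁ hO := fun n =>
    (mul_inv_mem_iff_residue O O₁ hO (hzO (n + 1)) (hzO n) (hz (n + 1)).2.2 (hz (n + 1)).2.1).mp (hdiv n)
  obtain ⟨n, hn⟩ := exists_valueRise_of_noetherian (residueValuationSubring O O₁ hO) Nb hN hNO r hrN hr0 hrdiv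
  exact hsep n ((mul_inv_mem_iff_residue O O₁ hO (hzO n) (hzO (n + 1)) (hz n).2.2 (hz n).2.1).mpr hn)

/-! ## No chain ⇒ termination ⇒ shadow capture -/

/-- **NO CHAIN ⇒ A REGULAR STAGE** (under StrictDrop, past a unit stage): `Coarsening.relativeACC_tower` with the unit moved up to
`max m₀ m₁` by radical persistence. [this work] -/
theorem terminates_of_noChain (hP : PersistenceRadical) (hD : StrictDrop) (p : ℕ) (hp : p.Prime)
    (k K : Type) [Field k] [CharP k p] [Field K] [Algebra k K] (O : ValuationSubring K) (A : Subalgebra k K)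
    (hk : ∀ c : k, algebraMap k K c ∈ O) (hA : A.FG) (hfr : IsFractionRing ↥A K) (hAO : A.toSubring ≤ O.toSubring)
    (O₁ : ValuationSubring K) (hO : O ≤ O₁) {m₁ : ℕ} (hunit : ∃ c ∈ ca (tower O A m₁), c ≠ 0 ∧ c⁻¹ ∈ O₁) (m₀ : ℕ)
    (hno : ¬ ∃ z : ℕ → K, (∀ n : ℕ, (∃ m : ℕ, m₀ ≤ m ∧ z n ∈ ca (tower O A m)) ∧ z n ≠ 0 ∧ (z n)⁻¹ ∈ O₁) ∧
      (∀ n : ℕ, z n * (z (n + 1))⁻¹ ∈ O) ∧ ∀ n : ℕ, z (n + 1) * (z n)⁻¹ ∉ O) :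
    ∃ m : ℕ, IsRegularLocalRing ↥(tower O A m) := by
  have hunit' : ∃ c ∈ ca (tower O A (max m₀ m₁)), c ≠ 0 ∧ c⁻¹ ∈ O₁ :=
    exists_unit_mem_ca_of_le hP p hp k K O A hk hA hfr hAO O₁ hunit (le_max_right _ _)
  refine Coarsening.relativeACC_tower hD p hp k K O A hk hA hfr hAO O₁ hO (max m₀ m₁) hunit' fun z hz hdiv => ?_
  by_contra hrise
  push Not at hrise
  exact hno ⟨z, fun n => by
    obtain ⟨⟨m, hm, hzm⟩, hz0, hzi⟩ := hz n
    exact ⟨⟨m, (le_max_left _ _).trans hm, hzm⟩, hz0, hzi⟩, hdiv, hrise⟩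

/-- **A REGULAR STAGE GIVES SHADOW CAPTURE**: with `N̄` := the image in `κ(O₁)` of the regular stage `T_m` (noetherian; inside `Ō` since
`T_m ⊆ O`), the residues of `ca(T_M) ⊆ T_M = T_m` (`M ≥ m`, stationarity) lie in `N̄`. [this work] -/
theorem shadowCapture_of_isRegularLocalRing_tower (O O₁ : ValuationSubring K) (hO : O ≤ O₁) (A : Subalgebra k K)
    (hk : ∀ c : k, algebraMap k K c ∈ O) (hA : A.FG) (hfr : IsFractionRing ↥A K) (hAO : A.toSubring ≤ O.toSubring)
    (m : ℕ) (hreg : IsRegularLocalRing ↥(tower O A m)) :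
    ∃ Nb : Subring (ResidueField ↥O₁), IsNoetherianRing ↥Nb ∧ Nb ≤ (residueValuationSubring O O₁ hO).toSubring ∧
      ∀ M : ℕ, m ≤ M → ∀ a ∈ ca (tower O A M), ∃ h : a ∈ O₁, residue ↥O₁ ⟨a, h⟩ ∈ Nb := by
  have hTO : (tower O A m).toSubring ≤ O.toSubring := fun x hx => TraceSocle.stage_le O A hk hAO m x hx
  have hTO₁ : (tower O A m).toSubring ≤ O₁.toSubring := fun x hx => hO (hTO hx)
  let φ : ↥(tower O A m).toSubring →+* ResidueField ↥O₁ := (residue ↥O₁).comp (Subring.inclusion hTO₁)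
  haveI : IsNoetherianRing ↥(tower O A m).toSubring := stub_towerNoetherian k K O A hk hA hfr hAO m
  refine ⟨φ.range, ?_, ?_, fun M hM a ha => ?_⟩
  · exact isNoetherianRing_of_surjective _ _ φ.rangeRestrict φ.rangeRestrict_surjective
  · rintro _ ⟨x, rfl⟩
    exact (residue_mem_residueValuationSubring_iff O O₁ hO _).mpr (hTO x.2)
  · have haT : a ∈ tower O A m := by
      have := ca_subset _ ha
      rwa [NoetherianCapture.tower_eq_of_le_of_isRegularLocalRing O A hk hfr hAO m hreg M hM] at this
    exact ⟨hTO₁ haT, ⟨⟨a, haT⟩, rfl⟩⟩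


/-! ## TEXT LEVEL: `E3^{E}` ⟺ `ShadowCapture3` -/

/-- **`E3^{E}` FROM SHADOW CAPTURE.**  `h` = ShadowCapture3 := the binders of `E3^{E}` (`…NoZenoFrozenDivisor`,
`noCaZenoChainSharp3_of_frozenDivisor`'s hypothesis) ⊢ «for some proper coarsening `O₁ ≠ K` a NOETHERIAN subring `N̄` of the residual valuation
ring `Ō ⊆ κ(O₁)` holds the residues of all late cohomology annihilators»; conclusion = `E3^{E}` verbatim (`noChain_of_shadowCapture`). [this work] -/
theorem e3E_of_shadowCapture3
    (h :
      PersistenceRadical → StrictDrop → ∀ p : ℕ, p.Prime → ∀ (k K : Type) [Field k] [CharP k p] [Field K]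
        [Algebra k K] (O : ValuationSubring K) (A : Subalgebra k K) (hk : ∀ c : k, algebraMap k K c ∈ O),
        A.FG → IsFractionRing ↥A K → A.toSubring ≤ O.toSubring →
        (∀ O' : ValuationSubring K,
          (∀ m : ℕ, ∀ s ∈ tower O A m, s ∈ O' ∧ (s⁻¹ ∈ O' → s⁻¹ ∈ O)) → ¬ IsNoetherianRing ↥O') →
        (∀ O' : ValuationSubring K, O < O' → ∃ m : ℕ, ∃ s ∈ tower O A m, s⁻¹ ∈ O' ∧ s⁻¹ ∉ O) →
        (∀ (k' K' : Type) [Field k'] [CharP k' p] [Field K'] [Algebra k' K'] (O' : ValuationSubring K')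
          (A' : Subalgebra k' K'), (∀ c : k', algebraMap k' K' c ∈ O') → A'.FG → IsFractionRing ↥A' K' →
          A'.toSubring ≤ O'.toSubring → Algebra.trdeg k' K' < Algebra.trdeg k K →
          ∃ m : ℕ, IsRegularLocalRing ↥(tower O' A' m)) →
        (∀ m : ℕ, ∀ s ∈ tower O A m, ∃ f : Polynomial k, f ≠ 0 ∧ O.valuation (Polynomial.aeval s f) < 1) →
        Algebra.trdeg k K = 3 →
        (∃ O₁ : ValuationSubring K, O < O₁ ∧ O₁ ≠ ⊤) →
        (∀ U : ValuationSubring K, O < U → ∃ z : ℕ → K, (∀ n : ℕ, z n ∈ O ∧ z n ≠ 0 ∧ (z n)⁻¹ ∈ U) ∧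
          (∀ n : ℕ, z n * (z (n + 1))⁻¹ ∈ O) ∧ ∀ n : ℕ, z (n + 1) * (z n)⁻¹ ∉ O) →
        (∀ (O₁ : ValuationSubring K) (h₁ : O < O₁), O₁ ≠ ⊤ →
          IsDiscreteValuationRing ↥O₁ ∧ residueTrdeg k O₁ (fun c => h₁.le (hk c)) = 2 ∧
          ∃ m : ℕ, ∀ M : ℕ, m ≤ M → (loc O₁ (tower O A M)).toSubring = O₁.toSubring) →
        (∀ x : K, x ∈ O → ∃ m : ℕ, x ∈ tower O A m) →
        ¬ SingularPrimeThread O A →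
        ∃ (O₁ : ValuationSubring K) (h₁ : O < O₁), O₁ ≠ ⊤ ∧ ∃ Nb : Subring (ResidueField ↥O₁),
          IsNoetherianRing ↥Nb ∧ Nb ≤ (residueValuationSubring O O₁ h₁.le).toSubring ∧
          ∃ m₀ : ℕ, ∀ M : ℕ, m₀ ≤ M → ∀ a ∈ ca (tower O A M), ∃ h : a ∈ O₁, residue ↥O₁ ⟨a, h⟩ ∈ Nb) :
    PersistenceRadical → StrictDrop → ∀ p : ℕ, p.Prime → ∀ (k K : Type) [Field k] [CharP k p] [Field K]
      [Algebra k K] (O : ValuationSubring K) (A : Subalgebra k K) (hk : ∀ c : k, algebraMap k K c ∈ O),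
      A.FG → IsFractionRing ↥A K → A.toSubring ≤ O.toSubring →
      (∀ O' : ValuationSubring K,
        (∀ m : ℕ, ∀ s ∈ tower O A m, s ∈ O' ∧ (s⁻¹ ∈ O' → s⁻¹ ∈ O)) → ¬ IsNoetherianRing ↥O') →
      (∀ O' : ValuationSubring K, O < O' → ∃ m : ℕ, ∃ s ∈ tower O A m, s⁻¹ ∈ O' ∧ s⁻¹ ∉ O) →
      (∀ (k' K' : Type) [Field k'] [CharP k' p] [Field K'] [Algebra k' K'] (O' : ValuationSubring K')
        (A' : Subalgebra k' K'), (∀ c : k', algebraMap k' K' c ∈ O') → A'.FG → IsFractionRing ↥A' K' →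
        A'.toSubring ≤ O'.toSubring → Algebra.trdeg k' K' < Algebra.trdeg k K →
        ∃ m : ℕ, IsRegularLocalRing ↥(tower O' A' m)) →
      (∀ m : ℕ, ∀ s ∈ tower O A m, ∃ f : Polynomial k, f ≠ 0 ∧ O.valuation (Polynomial.aeval s f) < 1) →
      Algebra.trdeg k K = 3 →
      (∃ O₁ : ValuationSubring K, O < O₁ ∧ O₁ ≠ ⊤) →
      (∀ U : ValuationSubring K, O < U → ∃ z : ℕ → K, (∀ n : ℕ, z n ∈ O ∧ z n ≠ 0 ∧ (z n)⁻¹ ∈ U) ∧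
        (∀ n : ℕ, z n * (z (n + 1))⁻¹ ∈ O) ∧ ∀ n : ℕ, z (n + 1) * (z n)⁻¹ ∉ O) →
      (∀ (O₁ : ValuationSubring K) (h₁ : O < O₁), O₁ ≠ ⊤ →
        IsDiscreteValuationRing ↥O₁ ∧ residueTrdeg k O₁ (fun c => h₁.le (hk c)) = 2 ∧
        ∃ m : ℕ, ∀ M : ℕ, m ≤ M → (loc O₁ (tower O A M)).toSubring = O₁.toSubring) →
      (∀ x : K, x ∈ O → ∃ m : ℕ, x ∈ tower O A m) →
      ¬ SingularPrimeThread O A →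
      ∃ O₁ : ValuationSubring K, O < O₁ ∧ O₁ ≠ ⊤ ∧ ∃ m₀ : ℕ, ¬ ∃ z : ℕ → K,
        (∀ n : ℕ, (∃ m : ℕ, m₀ ≤ m ∧ z n ∈ ca (tower O A m)) ∧ z n ≠ 0 ∧ (z n)⁻¹ ∈ O₁) ∧
        (∀ n : ℕ, z n * (z (n + 1))⁻¹ ∈ O) ∧ ∀ n : ℕ, z (n + 1) * (z n)⁻¹ ∉ O := by
  intro hP hD p hp k K _ _ _ _ O A hk hA hfr hAO hker hmax IH hzd htr hO₁ hnd hpd hexh hthr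
  obtain ⟨O₁, h₁, htop, Nb, hN, hNO, m₀, hcap⟩ :=
    h hP hD p hp k K O A hk hA hfr hAO hker hmax IH hzd htr hO₁ hnd hpd hexh hthr
  exact ⟨O₁, h₁, htop, m₀, noChain_of_shadowCapture O O₁ h₁.le A
    (fun m s hs => TraceSocle.stage_le O A hk hAO m s hs) Nb hN hNO m₀ hcap⟩

/-- **SHADOW CAPTURE FROM `E3^{E}`** (the converse: no chain ⇒ a regular stage (`terminates_of_noChain`) ⇒ capture by the image of the
stationary stage (`shadowCapture_of_isRegularLocalRing_tower`)).  So **`E3^{E}` ⟺ `ShadowCapture3`** — the slot-3 residual is the SURFACE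
statement «the shadows in `κ(E)` of the late conductors are captured by one noetherian subring of `Ō`». [this work] -/
theorem shadowCapture3_of_e3E
    (h :
      PersistenceRadical → StrictDrop → ∀ p : ℕ, p.Prime → ∀ (k K : Type) [Field k] [CharP k p] [Field K]
        [Algebra k K] (O : ValuationSubring K) (A : Subalgebra k K) (hk : ∀ c : k, algebraMap k K c ∈ O),
        A.FG → IsFractionRing ↥A K → A.toSubring ≤ O.toSubring →
        (∀ O' : ValuationSubring K,
          (∀ m : ℕ, ∀ s ∈ tower O A m, s ∈ O' ∧ (s⁻¹ ∈ O' → s⁻¹ ∈ O)) → ¬ IsNoetherianRing ↥O') →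
        (∀ O' : ValuationSubring K, O < O' → ∃ m : ℕ, ∃ s ∈ tower O A m, s⁻¹ ∈ O' ∧ s⁻¹ ∉ O) →
        (∀ (k' K' : Type) [Field k'] [CharP k' p] [Field K'] [Algebra k' K'] (O' : ValuationSubring K')
          (A' : Subalgebra k' K'), (∀ c : k', algebraMap k' K' c ∈ O') → A'.FG → IsFractionRing ↥A' K' →
          A'.toSubring ≤ O'.toSubring → Algebra.trdeg k' K' < Algebra.trdeg k K →
          ∃ m : ℕ, IsRegularLocalRing ↥(tower O' A' m)) →
        (∀ m : ℕ, ∀ s ∈ tower O A m, ∃ f : Polynomial k, f ≠ 0 ∧ O.valuation (Polynomial.aeval s f) < 1) →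
        Algebra.trdeg k K = 3 →
        (∃ O₁ : ValuationSubring K, O < O₁ ∧ O₁ ≠ ⊤) →
        (∀ U : ValuationSubring K, O < U → ∃ z : ℕ → K, (∀ n : ℕ, z n ∈ O ∧ z n ≠ 0 ∧ (z n)⁻¹ ∈ U) ∧
          (∀ n : ℕ, z n * (z (n + 1))⁻¹ ∈ O) ∧ ∀ n : ℕ, z (n + 1) * (z n)⁻¹ ∉ O) →
        (∀ (O₁ : ValuationSubring K) (h₁ : O < O₁), O₁ ≠ ⊤ →
          IsDiscreteValuationRing ↥O₁ ∧ residueTrdeg k O₁ (fun c => h₁.le (hk c)) = 2 ∧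
          ∃ m : ℕ, ∀ M : ℕ, m ≤ M → (loc O₁ (tower O A M)).toSubring = O₁.toSubring) →
        (∀ x : K, x ∈ O → ∃ m : ℕ, x ∈ tower O A m) →
        ¬ SingularPrimeThread O A →
        ∃ O₁ : ValuationSubring K, O < O₁ ∧ O₁ ≠ ⊤ ∧ ∃ m₀ : ℕ, ¬ ∃ z : ℕ → K,
          (∀ n : ℕ, (∃ m : ℕ, m₀ ≤ m ∧ z n ∈ ca (tower O A m)) ∧ z n ≠ 0 ∧ (z n)⁻¹ ∈ O₁) ∧
          (∀ n : ℕ, z n * (z (n + 1))⁻¹ ∈ O) ∧ ∀ n : ℕ, z (n + 1) * (z n)⁻¹ ∉ O) :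
    PersistenceRadical → StrictDrop → ∀ p : ℕ, p.Prime → ∀ (k K : Type) [Field k] [CharP k p] [Field K]
      [Algebra k K] (O : ValuationSubring K) (A : Subalgebra k K) (hk : ∀ c : k, algebraMap k K c ∈ O),
      A.FG → IsFractionRing ↥A K → A.toSubring ≤ O.toSubring →
      (∀ O' : ValuationSubring K,
        (∀ m : ℕ, ∀ s ∈ tower O A m, s ∈ O' ∧ (s⁻¹ ∈ O' → s⁻¹ ∈ O)) → ¬ IsNoetherianRing ↥O') →
      (∀ O' : ValuationSubring K, O < O' → ∃ m : ℕ, ∃ s ∈ tower O A m, s⁻¹ ∈ O' ∧ s⁻¹ ∉ O) →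
      (∀ (k' K' : Type) [Field k'] [CharP k' p] [Field K'] [Algebra k' K'] (O' : ValuationSubring K')
        (A' : Subalgebra k' K'), (∀ c : k', algebraMap k' K' c ∈ O') → A'.FG → IsFractionRing ↥A' K' →
        A'.toSubring ≤ O'.toSubring → Algebra.trdeg k' K' < Algebra.trdeg k K →
        ∃ m : ℕ, IsRegularLocalRing ↥(tower O' A' m)) →
      (∀ m : ℕ, ∀ s ∈ tower O A m, ∃ f : Polynomial k, f ≠ 0 ∧ O.valuation (Polynomial.aeval s f) < 1) →
      Algebra.trdeg k K = 3 →
      (∃ O₁ : ValuationSubring K, O < O₁ ∧ O₁ ≠ ⊤) →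
      (∀ U : ValuationSubring K, O < U → ∃ z : ℕ → K, (∀ n : ℕ, z n ∈ O ∧ z n ≠ 0 ∧ (z n)⁻¹ ∈ U) ∧
        (∀ n : ℕ, z n * (z (n + 1))⁻¹ ∈ O) ∧ ∀ n : ℕ, z (n + 1) * (z n)⁻¹ ∉ O) →
      (∀ (O₁ : ValuationSubring K) (h₁ : O < O₁), O₁ ≠ ⊤ →
        IsDiscreteValuationRing ↥O₁ ∧ residueTrdeg k O₁ (fun c => h₁.le (hk c)) = 2 ∧
        ∃ m : ℕ, ∀ M : ℕ, m ≤ M → (loc O₁ (tower O A M)).toSubring = O₁.toSubring) →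
      (∀ x : K, x ∈ O → ∃ m : ℕ, x ∈ tower O A m) →
      ¬ SingularPrimeThread O A →
      ∃ (O₁ : ValuationSubring K) (h₁ : O < O₁), O₁ ≠ ⊤ ∧ ∃ Nb : Subring (ResidueField ↥O₁),
        IsNoetherianRing ↥Nb ∧ Nb ≤ (residueValuationSubring O O₁ h₁.le).toSubring ∧
        ∃ m₀ : ℕ, ∀ M : ℕ, m₀ ≤ M → ∀ a ∈ ca (tower O A M), ∃ h : a ∈ O₁, residue ↥O₁ ⟨a, h⟩ ∈ Nb := by
  intro hP hD p hp k K _ _ _ _ O A hk hA hfr hAO hker hmax IH hzd htr hO₁ hnd hpd hexh hthr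
  obtain ⟨O₁, h₁, htop, m₀, hno⟩ := h hP hD p hp k K O A hk hA hfr hAO hker hmax IH hzd htr hO₁ hnd hpd hexh hthr
  obtain ⟨n₁, hc⟩ := exists_unitStage hP hD p hp k K O A hk hA hfr hAO hmax hthr O₁ h₁
  obtain ⟨m, hm⟩ := terminates_of_noChain hP hD p hp k K O A hk hA hfr hAO O₁ h₁.le hc m₀ hno
  obtain ⟨Nb, hN, hNO, hcap⟩ := shadowCapture_of_isRegularLocalRing_tower O O₁ h₁.le A hk hA hfr hAO m hm
  exact ⟨O₁, h₁, htop, Nb, hN, hNO, m, hcap⟩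

end Summit.ResolutionOfSingularities.ResolutionOfSingularities.Theorems.NoZeno.CompositeSplit

end
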